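import Literature.Barriers.CriticalPhenomena.LaceExpansionIsingDeconvolutionParts
import Literature.Barriers.CriticalPhenomena.LaceExpansionIsingGreenUniform
import Mathlib.Analysis.SpecialFunctions.Trigonometric.Bounds
import Mathlib.Analysis.Normed.Group.AddCircle
import HarnessLib

/-!
# The infrared bound (2.3) = (3.18) for `F̂_z` (Liu–Slade 2026): discharge of the named fact
# `LiuSlade2026_infraredBound`

Barrier catalogue `Literature/Barriers/CriticalPhenomena/` (D-0021), proofs companion of
`LaceExpansionIsingDeconvolutionParts.lean`, which vendors the deep inputs of the printed proof of
Liu–Slade 2026, Theorem 1.7 as named facts over the objects of §2.1. One of them is NOT deep and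
is PROVED here, along the three printed lines of its proof (Liu–Slade 2026, §3.2, (3.17)–(3.18)):

  "Together with (3.15), Assumption 2.1 implies an infrared bound for `F̂_z`. To see this, we
  first write `F̂_z(k) - F̂_z(0) = z(1 - D̂(k)) + (Π̂_z(0) - Π̂_z(k))` (3.17). The first term is
  bounded from below using `z ≥ 1` and (3.15), and the second term is bounded in absolute value
  by `O(β)(|k|² ∧ 1)`, by Taylor's theorem, symmetry, and (2.2). Since `β` is small, this yields
  `F̂_z(k) - F̂_z(0) ≥ K_IR (L²|k|² ∧ 1)` (`k ∈ 𝕋^d`) (3.18) for some `K_IR > 0`."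

* (3.15), the infrared bound `Â_1(k) - Â_1(0) = 1 - D̂(k) ≳ L²|k|² ∧ 1` of the spread-out step
  distribution (Lemma 3.6, "proved in [HS02]", App. B), is the tree's `infrared_lower_bound`
  (`LaceExpansionIsingGreenUniform.lean`: `1 - D̂(k) ≥ (1/16) min(L²‖k‖²_∞, 1)` on `[-π,π]^d`, for
  EVERY `d, L ≥ 1`, so that `L₀ = 1` here);
* (3.17) is linearity of the lattice Fourier transform (`re_latticeFT_lsF`), after passing from
  the torus `(ℝ/ℤ)^d` of `latticeFourier` to the cube `[-π,π]^d` of `latticeFT` through a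
  representative `y ∈ [-1/2,1/2]^d`, `k = -2πy`, on which the quotient norm is `‖t_i‖ = |y_i|`
  (`exists_rep_unitAddTorus`; the bridge `latticeFourier_coe_eq_latticeFT` of the parent file);
* the `Π`-term: `|Σ_x Π_z(x)(1 - cos(k·x))| ≤ β₁ min((S₂/2)|k|², 2S₀)` with the lattice sums
  `S₀ = Σ_x ⟦x⟧^{-(d+2+ρ)}`, `S₂ = Σ_x |x|²⟦x⟧^{-(d+2+ρ)}` (`abs_tsum_mul_one_sub_cos_le`:
  `1 - cos u ≤ u²/2 ∧ 2`, Cauchy–Schwarz `(k·x)² ≤ |k|²|x|²`; the `x = 0` term vanishes, so `β₀`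
  does not enter), which is the printed "`O(β)(|k|² ∧ 1)`";
* assembly (`LiuSlade2026_infraredBound_holds`): with `c_d = (1/16) min(4π²/d, 1)` (Euclidean
  `|y|² ≤ d‖y‖²_∞`), `C = max(2π²S₂, 2S₀)`, the constants are `K_IR = c_d/2`, `β⋆ = c_d/(2C)`,
  `L₀ = 1`, depending on `d, ρ` only.

## References

* Y. Liu, G. Slade, *Gaussian deconvolution and the lace expansion for spread-out models*,
  Ann. Inst. H. Poincaré Probab. Statist. 62 (2026), arXiv:2310.07640: Assumption 2.1 with (2.2),
  (2.3); §3.2: Lemma 3.6 with (3.15), (3.17)–(3.18); App. B ("The infrared bound (B.2) is proved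
  in [HS02]") [LiuSlade2026]. Equation numbers are those of the arXiv version held in the
  literature store.
* R. van der Hofstad, G. Slade, *A generalised inductive approach to the lace expansion*,
  Probab. Theory Related Fields 122 (2002) 389–430: §1.2, Assumption D (the infrared bound for
  spread-out `D`) [VanderhofstadSlade2002].
-/

noncomputable section

namespace Literature.Barriers.CriticalPhenomena.SpreadOutIsing

open Filter UnitAddTorus Literature.Probability.LatticeModels
open _root_.MeasureTheory _root_.Topology

variable {d L : ℕ}

/-! ### The torus `(ℝ/ℤ)^d` and the cube `[-π,π]^d` -/

/-- Every point of the torus `(ℝ/ℤ)^d` has a representative `y ∈ [-1/2, 1/2]^d`, and on it the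
quotient norm of `ℝ/ℤ` is `‖t_i‖ = |y_i|` (so that `|k|² = 4π² Σ_i ‖t_i‖²` for `k = 2πy`).
[folklore] -/
theorem exists_rep_unitAddTorus (t : UnitAddTorus (Fin d)) :
    ∃ y : Fin d → ℝ, (∀ i, |y i| ≤ 1 / 2) ∧ (fun i => ((y i : ℝ) : UnitAddCircle)) = t ∧
      ∀ i, ‖t i‖ = |y i| := by
  have h : ∀ i, ∃ x : ℝ, (x : UnitAddCircle) = t i := fun i =>
    QuotientAddGroup.mk_surjective (t i)
  choose x hx using h
  refine ⟨fun i => x i - round (x i), fun i => abs_sub_round (x i), ?_, fun i => ?_⟩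
  · funext i
    rw [← hx i, AddCircle.coe_sub, sub_eq_self, AddCircle.coe_eq_zero_iff]
    exact ⟨round (x i), by simp⟩
  · rw [← hx i, UnitAddCircle.norm_eq]

/-- The origin of the torus is the class of `0 ∈ ℝ^d`, so `F̂(0)` on the torus side is `F̂(0)` on
the cube side. [folklore] -/
theorem latticeFourier_zero_eq_latticeFT (F : Site d → ℝ) :
    latticeFourier F 0 = latticeFT F 0 := by
  have h0 : (0 : UnitAddTorus (Fin d)) = fun i => (((0 : Fin d → ℝ) i : ℝ) : UnitAddCircle) := by
    funext i
    simp
  rw [h0, latticeFourier_coe_eq_latticeFT, smul_zero]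

/-- `-2πy ∈ [-π,π]^d` for `y ∈ [-1/2,1/2]^d`. [folklore] -/
theorem smul_mem_cube_of_abs_le {y : Fin d → ℝ} (hy : ∀ i, |y i| ≤ 1 / 2) :
    (-(2 * Real.pi)) • y ∈ cube d := by
  intro i _
  have h := abs_le.1 (hy i)
  have hπ : 0 < Real.pi := Real.pi_pos
  simp only [Pi.smul_apply, smul_eq_mul, Set.mem_Icc]
  constructor <;> nlinarith [h.1, h.2]

/-- `Σ_i y_i² ≤ d ‖y‖²_∞`. [folklore] -/
theorem sum_sq_le_card_mul_norm_sq (y : Fin d → ℝ) : ∑ i, y i ^ 2 ≤ d * ‖y‖ ^ 2 := by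
  calc ∑ i, y i ^ 2 ≤ ∑ _i : Fin d, ‖y‖ ^ 2 := Finset.sum_le_sum fun i _ => by
          have h := norm_le_pi_norm y i
          rw [Real.norm_eq_abs] at h
          rw [← sq_abs]
          exact pow_le_pow_left₀ (abs_nonneg _) h 2
    _ = d * ‖y‖ ^ 2 := by simp

/-- `min a 1 · min u 1 ≤ min (a u) 1` for `a, u ≥ 0`. [folklore] -/
theorem min_one_mul_min_one_le {a u : ℝ} (ha : 0 ≤ a) (hu : 0 ≤ u) :
    min a 1 * min u 1 ≤ min (a * u) 1 := by
  refine le_min ?_ ?_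
  · exact mul_le_mul (min_le_left _ _) (min_le_left _ _) (le_min hu zero_le_one) ha
  · calc min a 1 * min u 1 ≤ 1 * 1 :=
          mul_le_mul (min_le_right _ _) (min_le_right _ _) (le_min hu zero_le_one) zero_le_one
      _ = 1 := one_mul 1

/-- `min (a u) b ≤ max a b · min u 1` for `u ≥ 0`. [folklore] -/
theorem min_mul_le_max_mul_min_one {a b u : ℝ} (hu : 0 ≤ u) :
    min (a * u) b ≤ max a b * min u 1 := by
  rcases le_or_gt u 1 with h | h
  · rw [min_eq_left h]
    calc min (a * u) b ≤ a * u := min_le_left _ _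
      _ ≤ max a b * u := mul_le_mul_of_nonneg_right (le_max_left _ _) hu
  · rw [min_eq_right h.le, mul_one]
    calc min (a * u) b ≤ b := min_le_right _ _
      _ ≤ max a b := le_max_right _ _

/-! ### (3.17): linearity, `F̂_z = 1 - zD̂ - Π̂_z` -/

/-- `δ_{0,x} ≤ ⟦x⟧^{-s}` (equality at `x = 0`). [folklore] -/
theorem delta0_le_one_div_jnorm_rpow (x : Site d) (s : ℝ) : delta0 x ≤ 1 / jnorm x ^ s := by
  by_cases hx : x = 0
  · subst hx
    simp
  · rw [delta0_of_ne_zero hx]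
    exact div_nonneg zero_le_one (Real.rpow_nonneg (jnorm_pos x).le s)

/-- Under the decay bound (2.2), `|Π_z(x)| ≤ (β₀ + β₁)⟦x⟧^{-(d+2+ρ)}`, so `Π_z` is absolutely
summable. [cite: LiuSlade2026, Assumption 2.1 with (2.2)] -/
theorem summable_abs_of_lsPiBound {P : Site d → ℝ} {β₀ β₁ s : ℝ} (hβ₀ : 0 ≤ β₀)
    (hs : (d : ℝ) < s) (hP : ∀ x : Site d, |P x| ≤ β₀ * delta0 x + β₁ / jnorm x ^ s) :
    Summable fun x => |P x| := by
  refine summable_abs_of_decay (C := β₀ + β₁) (s := s) (fun x => ?_) hs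
  calc |P x| ≤ β₀ * delta0 x + β₁ / jnorm x ^ s := hP x
    _ ≤ β₀ * (1 / jnorm x ^ s) + β₁ / jnorm x ^ s :=
        add_le_add (mul_le_mul_of_nonneg_left (delta0_le_one_div_jnorm_rpow x s) hβ₀) le_rfl
    _ = (β₀ + β₁) / jnorm x ^ s := by ring

/-- **(3.17), real parts**: `Re F̂_z(k) = 1 - z D̂(k) - Re Π̂_z(k)` for `F_z = δ - zD - Π_z` with
`Π_z` absolutely summable (`D̂ = soSymbol` is real). [cite: LiuSlade2026, (3.17)] -/
theorem re_latticeFT_lsF (z : ℝ) {P : Site d → ℝ} (hP : Summable fun x => |P x|)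
    (k : Fin d → ℝ) :
    (latticeFT (lsF d L z P) k).re = 1 - z * soSymbol d L k - (latticeFT P k).re := by
  have hD : Summable fun x => |z * soStep d L x| := by
    simpa only [abs_mul] using summable_abs_soStep.mul_left |z|
  have hA : Summable fun x => |delta0 x - z * soStep d L x| :=
    Summable.of_nonneg_of_le (fun x => abs_nonneg _) (fun x => abs_sub _ _)
      (summable_abs_delta0.add hD)
  have h : latticeFT (lsF d L z P) k =
      1 - (z : ℂ) * latticeFT (soStep d L) k - latticeFT P k := by
    show latticeFT (fun x => delta0 x - z * soStep d L x - P x) k = _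
    rw [latticeFT_sub hA hP, latticeFT_sub summable_abs_delta0 hD, latticeFT_const_mul,
      latticeFT_delta0]
  rw [h, Complex.sub_re, Complex.sub_re, Complex.one_re, Complex.re_ofReal_mul,
    soSymbol_eq_re_latticeFT]

/-- `Re Π̂(0) - Re Π̂(k) = Σ_x Π(x)(1 - cos(k·x))` for absolutely summable `Π`. [cite: LiuSlade2026, (3.17)] -/
theorem re_latticeFT_zero_sub_re {P : Site d → ℝ} (hP : Summable fun x => |P x|)
    (k : Fin d → ℝ) :
    (latticeFT P 0).re - (latticeFT P k).re = ∑' x, P x * (1 - Real.cos (kdot k x)) := by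
  rw [re_latticeFT hP, re_latticeFT hP,
    ← Summable.tsum_sub (summable_mul_cos hP 0) (summable_mul_cos hP k)]
  refine tsum_congr fun x => ?_
  rw [kdot_zero_left, Real.cos_zero]
  ring

/-! ### The `Π`-term: "bounded in absolute value by `O(β)(|k|² ∧ 1)`, by Taylor's theorem,
symmetry, and (2.2)" -/

/-- `1 - cos(k·x) ≤ |k|²|x|²/2` (Taylor: `1 - cos u ≤ u²/2`, and Cauchy–Schwarz). [folklore] -/
theorem one_sub_cos_kdot_le (k : Fin d → ℝ) (x : Site d) :
    1 - Real.cos (kdot k x) ≤ (∑ i, k i ^ 2) * euclidNorm x ^ 2 / 2 := by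
  have h1 : 1 - Real.cos (kdot k x) ≤ kdot k x ^ 2 / 2 := by
    linarith [Real.one_sub_sq_div_two_le_cos (x := kdot k x)]
  have h2 : kdot k x ^ 2 ≤ (∑ i, k i ^ 2) * euclidNorm x ^ 2 := by
    rw [euclidNorm_sq]
    exact Finset.sum_mul_sq_le_sq_mul_sq _ _ _
  linarith

/-- **The `Π`-term bound.** If `|Π(x)| ≤ β₀δ_{0,x} + β₁⟦x⟧^{-s}` with `s - 2 > d`, then for every
`k ∈ ℝ^d`, `|Σ_x Π(x)(1 - cos(k·x))| ≤ β₁ min((S₂/2)|k|², 2S₀)`, where `S₀ = Σ_x ⟦x⟧^{-s}` and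
`S₂ = Σ_x |x|²⟦x⟧^{-s}` (the `x = 0` term vanishes, so `β₀` does not enter).
[cite: LiuSlade2026, §3.2, sentence after (3.17)] -/
theorem abs_tsum_mul_one_sub_cos_le {P : Site d → ℝ} {β₀ β₁ s : ℝ} (hβ₁ : 0 ≤ β₁)
    (hsd : (d : ℝ) < s - 2) (hP : ∀ x : Site d, |P x| ≤ β₀ * delta0 x + β₁ / jnorm x ^ s)
    (k : Fin d → ℝ) :
    |∑' x, P x * (1 - Real.cos (kdot k x))| ≤
      β₁ * min ((∑' x : Site d, euclidNorm x ^ 2 * jnorm x ^ (-s)) / 2 * ∑ i, k i ^ 2)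
        (2 * ∑' x : Site d, jnorm x ^ (-s)) := by
  have hs0 : (d : ℝ) < s := by linarith
  -- the two lattice sums converge
  have hS₀ : Summable fun x : Site d => jnorm x ^ (-s) := summable_jnorm_rpow_neg hs0
  have hS₂ : Summable fun x : Site d => euclidNorm x ^ 2 * jnorm x ^ (-s) := by
    have h := summable_rpow_mul_abs_of_decay (f := fun x : Site d => jnorm x ^ (-s)) (C := 1)
      (s := s) (a := 2) (fun x => ?_) zero_le_two hsd
    · refine h.congr fun x => ?_
      simp only [Real.rpow_two, abs_of_nonneg (Real.rpow_nonneg (jnorm_pos x).le _)]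
    · rw [abs_of_nonneg (Real.rpow_nonneg (jnorm_pos x).le _), Real.rpow_neg (jnorm_pos x).le,
        one_div]
  have hcos0 : ∀ x : Site d, 0 ≤ 1 - Real.cos (kdot k x) := fun x => by
    linarith [Real.cos_le_one (kdot k x)]
  have hcos2 : ∀ x : Site d, 1 - Real.cos (kdot k x) ≤ 2 := fun x => by
    linarith [Real.neg_one_le_cos (kdot k x)]
  have hjs : ∀ x : Site d, 0 ≤ jnorm x ^ (-s) := fun x => Real.rpow_nonneg (jnorm_pos x).le _
  -- termwise: `|Π(x)(1 - cos(k·x))| ≤ β₁⟦x⟧^{-s}(1 - cos(k·x))` (both sides vanish at `x = 0`)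
  have hterm : ∀ x : Site d, ‖P x * (1 - Real.cos (kdot k x))‖ ≤
      β₁ * jnorm x ^ (-s) * (1 - Real.cos (kdot k x)) := by
    intro x
    rw [Real.norm_eq_abs, abs_mul, abs_of_nonneg (hcos0 x)]
    by_cases hx : x = 0
    · subst hx
      simp
    · refine mul_le_mul_of_nonneg_right ?_ (hcos0 x)
      calc |P x| ≤ β₀ * delta0 x + β₁ / jnorm x ^ s := hP x
        _ = β₁ * jnorm x ^ (-s) := by
            rw [delta0_of_ne_zero hx, mul_zero, zero_add, Real.rpow_neg (jnorm_pos x).le,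
              div_eq_mul_inv]
  -- the majorant is summable (it is at most `2β₁⟦x⟧^{-s}`)
  have hmajB : ∀ x : Site d, β₁ * jnorm x ^ (-s) * (1 - Real.cos (kdot k x)) ≤
      β₁ * 2 * jnorm x ^ (-s) := fun x => by
    calc β₁ * jnorm x ^ (-s) * (1 - Real.cos (kdot k x)) ≤ β₁ * jnorm x ^ (-s) * 2 :=
          mul_le_mul_of_nonneg_left (hcos2 x) (mul_nonneg hβ₁ (hjs x))
      _ = β₁ * 2 * jnorm x ^ (-s) := by ring
  have hmaj0 : ∀ x : Site d, 0 ≤ β₁ * jnorm x ^ (-s) * (1 - Real.cos (kdot k x)) := fun x =>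
    mul_nonneg (mul_nonneg hβ₁ (hjs x)) (hcos0 x)
  have hsumB : Summable fun x : Site d => β₁ * 2 * jnorm x ^ (-s) := hS₀.mul_left (β₁ * 2)
  have hmaj : Summable fun x : Site d => β₁ * jnorm x ^ (-s) * (1 - Real.cos (kdot k x)) :=
    Summable.of_nonneg_of_le hmaj0 hmajB hsumB
  have hnorm : Summable fun x : Site d => ‖P x * (1 - Real.cos (kdot k x))‖ :=
    Summable.of_nonneg_of_le (fun x => norm_nonneg _) hterm hmaj
  -- the majorant for the quadratic bound
  have hmajA : ∀ x : Site d, β₁ * jnorm x ^ (-s) * (1 - Real.cos (kdot k x)) ≤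
      β₁ * ((∑ i, k i ^ 2) / 2) * (euclidNorm x ^ 2 * jnorm x ^ (-s)) := fun x => by
    calc β₁ * jnorm x ^ (-s) * (1 - Real.cos (kdot k x))
        ≤ β₁ * jnorm x ^ (-s) * ((∑ i, k i ^ 2) * euclidNorm x ^ 2 / 2) :=
          mul_le_mul_of_nonneg_left (one_sub_cos_kdot_le k x) (mul_nonneg hβ₁ (hjs x))
      _ = β₁ * ((∑ i, k i ^ 2) / 2) * (euclidNorm x ^ 2 * jnorm x ^ (-s)) := by ring
  have hsumA : Summable fun x : Site d =>
      β₁ * ((∑ i, k i ^ 2) / 2) * (euclidNorm x ^ 2 * jnorm x ^ (-s)) :=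
    hS₂.mul_left _
  have hmain : |∑' x, P x * (1 - Real.cos (kdot k x))| ≤
      ∑' x, β₁ * jnorm x ^ (-s) * (1 - Real.cos (kdot k x)) := by
    calc |∑' x, P x * (1 - Real.cos (kdot k x))| = ‖∑' x, P x * (1 - Real.cos (kdot k x))‖ :=
          (Real.norm_eq_abs _).symm
      _ ≤ ∑' x, ‖P x * (1 - Real.cos (kdot k x))‖ := norm_tsum_le_tsum_norm hnorm
      _ ≤ ∑' x, β₁ * jnorm x ^ (-s) * (1 - Real.cos (kdot k x)) :=
          Summable.tsum_le_tsum hterm hnorm hmaj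
  rw [mul_min_of_nonneg _ _ hβ₁]
  refine le_min (hmain.trans ?_) (hmain.trans ?_)
  · calc ∑' x, β₁ * jnorm x ^ (-s) * (1 - Real.cos (kdot k x))
        ≤ ∑' x, β₁ * ((∑ i, k i ^ 2) / 2) * (euclidNorm x ^ 2 * jnorm x ^ (-s)) :=
          Summable.tsum_le_tsum hmajA hmaj hsumA
      _ = β₁ * ((∑ i, k i ^ 2) / 2) * ∑' x : Site d, euclidNorm x ^ 2 * jnorm x ^ (-s) :=
          tsum_mul_left
      _ = β₁ * ((∑' x : Site d, euclidNorm x ^ 2 * jnorm x ^ (-s)) / 2 * ∑ i, k i ^ 2) := by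
          ring
  · calc ∑' x, β₁ * jnorm x ^ (-s) * (1 - Real.cos (kdot k x))
        ≤ ∑' x, β₁ * 2 * jnorm x ^ (-s) := Summable.tsum_le_tsum hmajB hmaj hsumB
      _ = β₁ * 2 * ∑' x : Site d, jnorm x ^ (-s) := tsum_mul_left
      _ = β₁ * (2 * ∑' x : Site d, jnorm x ^ (-s)) := by ring

/-! ### (3.18): the discharge -/

/-- **Discharge of the named fact `LiuSlade2026_infraredBound`** — the infrared bound (2.3) = (3.18)
for `F̂_z`: under Assumption 2.1 (without its sign condition), for `β = β₀ ∨ β₁ ≤ β⋆(d, ρ)` and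
every `L ≥ 1`, `F̂_z(k) - F̂_z(0) ≥ K_IR (L²|k|² ∧ 1)` on `𝕋^d` with `K_IR = K_IR(d) > 0`; in the
coordinate `k = 2πt` of `latticeFourier`, `|k|²` is replaced by `Σ_i ‖t_i‖²`. Proof as printed
((3.17); `z ≥ 1` and the infrared bound (3.15) for `D̂`, here the tree's `infrared_lower_bound`;
the `Π`-term `abs_tsum_mul_one_sub_cos_le`; `β` small), with the explicit constants
`K_IR = c_d/2`, `β⋆ = c_d/(2 max(2π²S₂, 2S₀))`, `c_d = (1/16) min(4π²/d, 1)`, `L₀ = 1`.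
[cite: LiuSlade2026, (2.3), (3.17)–(3.18) and Lemma 3.6 (3.15)] [cite: VanderhofstadSlade2002, §1.2, Assumption D (infrared bound for spread-out D)] -/
theorem LiuSlade2026_infraredBound_holds : LiuSlade2026_infraredBound := by
  intro d hd ρ hρ
  have hπ : 0 < Real.pi := Real.pi_pos
  have hd0 : (0 : ℝ) < d := by exact_mod_cast hd
  -- the exponent `s = d + 2 + ρ` of (2.2)
  set s : ℝ := (d : ℝ) + 2 + ρ with hsdef
  have hρ0 : 0 < ρ := lt_of_le_of_lt (le_max_right _ _) hρ
  have hsd2 : (d : ℝ) < s - 2 := by rw [hsdef]; linarith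
  have hsd : (d : ℝ) < s := by linarith
  -- the lattice sums `S₀ = Σ ⟦x⟧^{-s} ≥ 1`, `S₂ = Σ |x|²⟦x⟧^{-s} ≥ 0` and the constants
  set S₀ : ℝ := ∑' x : Site d, jnorm x ^ (-s) with hS₀def
  set S₂ : ℝ := ∑' x : Site d, euclidNorm x ^ 2 * jnorm x ^ (-s) with hS₂def
  have hS₀ : 1 ≤ S₀ := by
    have h := (summable_jnorm_rpow_neg hsd).le_tsum (0 : Site d)
      (fun x _ => Real.rpow_nonneg (jnorm_pos x).le _)
    simpa using h
  have hS₂ : 0 ≤ S₂ :=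
    tsum_nonneg fun x => mul_nonneg (sq_nonneg _) (Real.rpow_nonneg (jnorm_pos x).le _)
  set C : ℝ := max (2 * Real.pi ^ 2 * S₂) (2 * S₀) with hCdef
  have hC : 0 < C := lt_of_lt_of_le (by linarith) (le_max_right _ _)
  set c : ℝ := 1 / 16 * min (4 * Real.pi ^ 2 / d) 1 with hcdef
  have hc : 0 < c := by
    have : 0 < min (4 * Real.pi ^ 2 / d) 1 := lt_min (by positivity) one_pos
    rw [hcdef]; positivity
  refine ⟨c / (2 * C), by positivity, c / 2, by positivity, 1, ?_⟩
  intro L hL z β₀ β₁ Pz hβ₀ hβ₁ hβ hz _hsymm hP t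
  have hL1 : (1 : ℝ) ≤ L := by exact_mod_cast hL
  -- absolute summability of `Π_z`
  have hPsum : Summable fun x => |Pz x| := summable_abs_of_lsPiBound hβ₀ hsd hP
  -- a representative `y ∈ [-1/2,1/2]^d` of `t`, and `k = -2πy ∈ [-π,π]^d`
  obtain ⟨y, hy, hty, hnorm⟩ := exists_rep_unitAddTorus t
  have hsum : ∑ i, ‖t i‖ ^ 2 = ∑ i, y i ^ 2 :=
    Finset.sum_congr rfl fun i _ => by rw [hnorm i, sq_abs]
  set k : Fin d → ℝ := (-(2 * Real.pi)) • y with hkdef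
  have hk : k ∈ cube d := smul_mem_cube_of_abs_le hy
  have hki : ∀ i, k i = -(2 * Real.pi) * y i := fun i => by simp [hkdef]
  have hksq : ∑ i, k i ^ 2 = 4 * Real.pi ^ 2 * ∑ i, y i ^ 2 := by
    rw [Finset.mul_sum]
    exact Finset.sum_congr rfl fun i _ => by rw [hki]; ring
  have hknorm : ‖k‖ = 2 * Real.pi * ‖y‖ := by
    rw [hkdef, norm_smul, Real.norm_eq_abs, abs_neg, abs_of_pos (by positivity)]
  -- (3.17): `Re F̂_z(k) - Re F̂_z(0) = z(1 - D̂(k)) + Σ_x Π_z(x)(1 - cos(k·x))`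
  have h317 : (latticeFourier (lsF d L z Pz) t).re - (latticeFourier (lsF d L z Pz) 0).re =
      z * (1 - soSymbol d L k) + ∑' x, Pz x * (1 - Real.cos (kdot k x)) := by
    rw [← hty, latticeFourier_coe_eq_latticeFT, latticeFourier_zero_eq_latticeFT,
      re_latticeFT_lsF z hPsum, re_latticeFT_lsF z hPsum, soSymbol_zero hd hL,
      ← re_latticeFT_zero_sub_re hPsum]
    ring
  -- the quantity `m = L²|y|² ∧ 1` of the statement
  set m : ℝ := min ((L : ℝ) ^ 2 * ∑ i, y i ^ 2) 1 with hmdef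
  have hy2 : 0 ≤ ∑ i, y i ^ 2 := Finset.sum_nonneg fun i _ => sq_nonneg _
  have hm0 : 0 ≤ m := le_min (by positivity) zero_le_one
  -- first term: `z(1 - D̂(k)) ≥ 1 - D̂(k) ≥ c · m` ((3.15) = `infrared_lower_bound`)
  have hIR : c * m ≤ 1 - soSymbol d L k := by
    have h := infrared_lower_bound hd hL hk
    have hcmp : min (4 * Real.pi ^ 2 / d) 1 * m ≤ min ((L : ℝ) ^ 2 * ‖k‖ ^ 2) 1 := by
      calc min (4 * Real.pi ^ 2 / d) 1 * m
          ≤ min (4 * Real.pi ^ 2 / d * ((L : ℝ) ^ 2 * ∑ i, y i ^ 2)) 1 :=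
            min_one_mul_min_one_le (by positivity) (by positivity)
        _ ≤ min ((L : ℝ) ^ 2 * ‖k‖ ^ 2) 1 := by
            refine min_le_min_right _ ?_
            have hyn : ∑ i, y i ^ 2 ≤ d * ‖y‖ ^ 2 := sum_sq_le_card_mul_norm_sq y
            rw [hknorm, div_mul_eq_mul_div, div_le_iff₀ hd0]
            calc 4 * Real.pi ^ 2 * ((L : ℝ) ^ 2 * ∑ i, y i ^ 2)
                = 4 * Real.pi ^ 2 * (L : ℝ) ^ 2 * ∑ i, y i ^ 2 := by ring
              _ ≤ 4 * Real.pi ^ 2 * (L : ℝ) ^ 2 * (d * ‖y‖ ^ 2) :=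
                  mul_le_mul_of_nonneg_left hyn (by positivity)
              _ = (L : ℝ) ^ 2 * (2 * Real.pi * ‖y‖) ^ 2 * d := by ring
    calc c * m = 1 / 16 * (min (4 * Real.pi ^ 2 / d) 1 * m) := by rw [hcdef]; ring
      _ ≤ 1 / 16 * min ((L : ℝ) ^ 2 * ‖k‖ ^ 2) 1 := by gcongr
      _ ≤ 1 - soSymbol d L k := h
  have hfirst : c * m ≤ z * (1 - soSymbol d L k) := by
    have h0 : 0 ≤ 1 - soSymbol d L k := by linarith [(abs_le.1 (abs_soSymbol_le_one (L := L) k)).2]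
    calc c * m ≤ 1 - soSymbol d L k := hIR
      _ = 1 * (1 - soSymbol d L k) := (one_mul _).symm
      _ ≤ z * (1 - soSymbol d L k) := mul_le_mul_of_nonneg_right hz h0
  -- second term: `|Σ Π_z(x)(1 - cos(k·x))| ≤ β₁ C (|y|² ∧ 1) ≤ β₁ C m`
  have hsecond : |∑' x, Pz x * (1 - Real.cos (kdot k x))| ≤ β₁ * C * m := by
    have h := abs_tsum_mul_one_sub_cos_le hβ₁ hsd2 hP k
    rw [← hS₀def, ← hS₂def, hksq] at h
    calc |∑' x, Pz x * (1 - Real.cos (kdot k x))|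
        ≤ β₁ * min (S₂ / 2 * (4 * Real.pi ^ 2 * ∑ i, y i ^ 2)) (2 * S₀) := h
      _ = β₁ * min (2 * Real.pi ^ 2 * S₂ * ∑ i, y i ^ 2) (2 * S₀) := by ring_nf
      _ ≤ β₁ * (C * min (∑ i, y i ^ 2) 1) :=
          mul_le_mul_of_nonneg_left (min_mul_le_max_mul_min_one hy2) hβ₁
      _ ≤ β₁ * (C * m) := by
          refine mul_le_mul_of_nonneg_left (mul_le_mul_of_nonneg_left ?_ hC.le) hβ₁
          refine min_le_min_right _ ?_
          calc ∑ i, y i ^ 2 = 1 * ∑ i, y i ^ 2 := (one_mul _).symm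
            _ ≤ (L : ℝ) ^ 2 * ∑ i, y i ^ 2 :=
                mul_le_mul_of_nonneg_right (one_le_pow₀ hL1) hy2
      _ = β₁ * C * m := by ring
  -- `β` small: `β₁ C ≤ c/2`
  have hβ₁C : β₁ * C ≤ c / 2 := by
    have hβ₁' : β₁ ≤ c / (2 * C) := (le_max_right β₀ β₁).trans hβ
    calc β₁ * C ≤ c / (2 * C) * C := mul_le_mul_of_nonneg_right hβ₁' hC.le
      _ = c / 2 := by field_simp
  -- assembly
  rw [hsum, h317]
  have habs := (abs_le.1 hsecond).1
  calc c / 2 * min ((L : ℝ) ^ 2 * ∑ i, y i ^ 2) 1 = c * m - c / 2 * m := by rw [← hmdef]; ring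
    _ ≤ c * m - β₁ * C * m := by nlinarith
    _ ≤ z * (1 - soSymbol d L k) + ∑' x, Pz x * (1 - Real.cos (kdot k x)) := by linarith

end Literature.Barriers.CriticalPhenomena.SpreadOutIsing

end
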